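import Literature.Probability.LatticeModels.PlaneRotatorIsingComparison
import Literature.Probability.LatticeModels.TorusQuarticFieldLaplace
import HarnessLib

/-!
# Aizenman–Simon's comparison "plane rotor at `2β` ≤ Ising at `β`" — PROOF of the named fact
# `PlaneRotator.AizenmanSimonRotorIsingComparison`

Topic `Literature/Probability/LatticeModels`. M. Aizenman, B. Simon, *A comparison of plane rotor and Ising models*, Phys. Lett.
**76A** (1980) 281–282 [AizenmanSimon1980RotorIsing], eq. (1): for every finite vertex set, every array `c ≥ 0` of ordered-pair
couplings and all sites `a, b`, `⟨cos(θ_a − θ_b)⟩^{rotor}_{2c} ≤ ⟨σ_aσ_b⟩^{Ising}_c` (typed as `PlaneRotator.AizenmanSimonRotorIsingComparison`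
in `PlaneRotatorIsingComparison.lean`, rotor side `PlaneRotator.twoPoint`, Ising side `PairIsing.avg … (spinPair a b)`). The paper's
two steps, "neither of which is new", formalised:

* §1 **Ginibre step** — the rotor couplings on ordered pairs and the quartic single-site characters `θ ↦ θ_x⁴` (coupling `λ`) form ONE
  Ginibre model with character family `(V × V) ⊕ V` (`asChars`, `asCoupling`); the tree's `ginibreExpect_reChar_mono` (torus, every
  element a square) gives `⟨cos(θ_a − θ_b)⟩_{2c} = F(0) ≤ F(λ)` for all `λ ≥ 0` (`twoPoint_le_asTwoPoint`).
* §2 **Suzuki step** — at a quarter-turn configuration `θ_x = i^{k_x}` the two Ising spins `σ = ![1,1,−1,−1] ∘ k`, `τ = ![1,−1,−1,1] ∘ k`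
  satisfy `cos(θ_y − θ_x) = (σ_xσ_y + τ_xτ_y)/2` (`re_conj_quarterTurn_mul_quarterTurn`, 16 cases), `k ↦ (σ, τ)` is a bijection
  (`suzukiCfgEquiv`), so the rotor weight at `2c` factorises into two Ising weights at `c` and the clock two-point function IS the Ising
  one (`clock_twoPoint_eq_ising`, finite sums).
* §3 **Assembly** — `F(λ) →` clock two-point function (`tendsto_laplace_quarticField` of `TorusQuarticFieldLaplace.lean` applied to
  numerator and denominator) `=` Ising two-point function; `twoPoint ≤ lim F` (`ge_of_tendsto`). Hence
  **`AizenmanSimonRotorIsingComparison_holds`**.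

Everything is PROVED (standard axioms; `decide` only on the 4- and 16-element Suzuki tables). Written for the hubbard-tc cell (MO-S3,
seat p1, 2026-08-27): removes the named-fact debt behind the cell's K5 / T6′ row "`T_c^{XY}(J∥, J⊥) ≤ ½·T_c^{Is}(J∥, J⊥)`"
(consequence (2) of the paper, with the tree's layered-Ising mean-field bound). Consequence (2) itself (critical temperatures, infinite
volume) is not stated here — the tree has no rotor `T_c`.

## References

* M. Aizenman, B. Simon, Phys. Lett. 76A (1980) 281–282, eqs. (1), (4)–(6). [AizenmanSimon1980RotorIsing]
* J. Ginibre, Comm. Math. Phys. 16 (1970) 310–328. [Ginibre1970]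
* M. Suzuki, Prog. Theor. Phys. 37 (1967) 770 (the `ℤ₄ ≅` Ising × Ising identity).
-/

noncomputable section

open MeasureTheory Filter Finset
open scoped Topology BigOperators ComplexConjugate

namespace Literature.Probability.LatticeModels

namespace PlaneRotator

/-! ### §1 The Ginibre step: the quartic field can only raise the rotor two-point function -/

section GinibreStep

variable {V : Type*} [Fintype V] [MeasurableSpace Circle] [BorelSpace Circle]


/-- The Aizenman–Simon interpolating family: rotor couplings `J` on ordered pairs plus the quartic single-site field of
strength `λ`, as ONE Ginibre model with character family `(V × V) ⊕ V`. [cite: AizenmanSimon1980RotorIsing, eq. (4)] -/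
def asChars (V : Type*) [Fintype V] : (V × V) ⊕ V → (V → Circle) →ₜ* Circle :=
  Sum.elim (pairChars V) quarticChar

/-- The couplings of the interpolating family: `J` on the pair characters, `λ` on every quartic character. [cite: AizenmanSimon1980RotorIsing, eq. (4)] -/
def asCoupling (J : V × V → ℝ) (lam : ℝ) : (V × V) ⊕ V → ℝ :=
  Sum.elim J fun _ => lam

omit [MeasurableSpace Circle] [BorelSpace Circle] in
/-- The interpolating weight factorises: `e^{∑ J Re χ + λ Φ} = e^{∑ J Re χ} · e^{λ Φ}`. [cite: AizenmanSimon1980RotorIsing, eqs. (4)-(6)] -/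
theorem ginibreWeight_asChars (J : V × V → ℝ) (lam : ℝ) (θ : V → Circle) :
    ginibreWeight (asChars V) (asCoupling J lam) θ =
      ginibreWeight (pairChars V) J θ * Real.exp (lam * quarticField θ) := by
  rw [ginibreWeight, ginibreWeight, ← Real.exp_add, ginibreHamiltonian, ginibreHamiltonian,
    Fintype.sum_sum_type, quarticField, Finset.mul_sum]
  rfl

/-- The two-point function of the interpolating family, `F(λ) = ⟨cos(θ_a − θ_b)⟩_{J, λ}`. [cite: AizenmanSimon1980RotorIsing, eq. (5)] -/
def asTwoPoint (J : V × V → ℝ) (lam : ℝ) (a b : V) : ℝ :=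
  ginibreExpect (torusHaar V) (asChars V) (asCoupling J lam) (cosDiff a b)

/-- At `λ = 0` the interpolating two-point function is the rotor two-point function. [cite: AizenmanSimon1980RotorIsing, eq. (5)] -/
theorem asTwoPoint_zero (J : V × V → ℝ) (a b : V) : asTwoPoint J 0 a b = twoPoint J a b := by
  unfold asTwoPoint twoPoint ginibreExpect
  simp_rw [ginibreWeight_asChars, zero_mul, Real.exp_zero, mul_one]

/-- The interpolating two-point function as a ratio of quartic-tilted rotor integrals. [cite: AizenmanSimon1980RotorIsing, eq. (5)] -/
theorem asTwoPoint_eq (J : V × V → ℝ) (lam : ℝ) (a b : V) :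
    asTwoPoint J lam a b =
      (∫ θ, cosDiff a b θ * ginibreWeight (pairChars V) J θ * Real.exp (lam * quarticField θ) ∂torusHaar V) /
        ∫ θ, ginibreWeight (pairChars V) J θ * Real.exp (lam * quarticField θ) ∂torusHaar V := by
  unfold asTwoPoint ginibreExpect
  simp_rw [ginibreWeight_asChars, mul_assoc]

/-- **Ginibre step of Aizenman–Simon**: for ferromagnetic `J ≥ 0` the quartic field can only RAISE the two-point function,
`⟨cos(θ_a − θ_b)⟩_J ≤ ⟨cos(θ_a − θ_b)⟩_{J, λ}` for every `λ ≥ 0`. [cite: AizenmanSimon1980RotorIsing, eq. (5)] -/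
theorem twoPoint_le_asTwoPoint {J : V × V → ℝ} (hJ : ∀ p, 0 ≤ J p) {lam : ℝ} (hlam : 0 ≤ lam) (a b : V) :
    twoPoint J a b ≤ asTwoPoint J lam a b := by
  rw [← asTwoPoint_zero]
  unfold asTwoPoint
  rw [show (cosDiff a b : (V → Circle) → ℝ) = reChar (diffChar a b) from funext fun θ => cosDiff_eq_reChar a b θ]
  refine ginibreExpect_reChar_mono _ surjective_mul_self_torus _ _ (fun i => ?_) (fun i => ?_)
  · cases i with
    | inl p => exact hJ p
    | inr x => exact le_rfl
  · cases i with
    | inl p => exact le_rfl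
    | inr x => exact hlam

end GinibreStep

/-! ### §2 Suzuki's isomorphism: the `ℤ₄` clock model is two decoupled Ising models -/

section Suzuki

/-- Suzuki's first Ising spin `σ(j)` of the clock state `j ∈ ℤ/4`: `cos(jπ/2) = (σ + τ)/2`. [cite: AizenmanSimon1980RotorIsing, eq. (6)] -/
def suzukiSigma : Fin 4 → ℤˣ := ![1, 1, -1, -1]

/-- Suzuki's second Ising spin `τ(j)`: `sin(jπ/2) = (σ − τ)/2`. [cite: AizenmanSimon1980RotorIsing, eq. (6)] -/
def suzukiTau : Fin 4 → ℤˣ := ![1, -1, -1, 1]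

/-- **Suzuki's bijection `ℤ/4 ≃ {±1} × {±1}`**, `j ↦ (σ(j), τ(j))`. [cite: AizenmanSimon1980RotorIsing, eq. (6)] -/
def suzukiEquiv : Fin 4 ≃ ℤˣ × ℤˣ where
  toFun j := (suzukiSigma j, suzukiTau j)
  invFun p := if p.1 = 1 then (if p.2 = 1 then 0 else 1) else (if p.2 = 1 then 3 else 2)
  left_inv := by decide
  right_inv := by decide

/-- Unfolding of `suzukiEquiv`. [cite: AizenmanSimon1980RotorIsing, eqs. (4)-(6)] -/
@[simp] theorem suzukiEquiv_apply (j : Fin 4) : suzukiEquiv j = (suzukiSigma j, suzukiTau j) := rfl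

/-- **The clock cosine is the average of the two Ising bonds**: `cos((j' − j)π/2) = Re( \overline{i^j} · i^{j'} ) = (σσ' + ττ')/2`.
[cite: AizenmanSimon1980RotorIsing, eq. (6)] -/
theorem re_conj_quarterTurn_mul_quarterTurn (j j' : Fin 4) :
    (conj (quarterTurn j : ℂ) * quarterTurn j').re =
      (((suzukiSigma j : ℤ) : ℝ) * ((suzukiSigma j' : ℤ) : ℝ) + ((suzukiTau j : ℤ) : ℝ) * ((suzukiTau j' : ℤ) : ℝ)) / 2 := by
  fin_cases j <;> fin_cases j' <;> simp [suzukiSigma, suzukiTau, pow_succ]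

variable {V : Type*} [Fintype V] [DecidableEq V]

/-- The first Suzuki Ising configuration of a clock configuration. [cite: AizenmanSimon1980RotorIsing, eq. (6)] -/
def suzukiSigmaCfg (k : V → Fin 4) : SpinConfig V := fun x => suzukiSigma (k x)

/-- The second Suzuki Ising configuration of a clock configuration. [cite: AizenmanSimon1980RotorIsing, eq. (6)] -/
def suzukiTauCfg (k : V → Fin 4) : SpinConfig V := fun x => suzukiTau (k x)

/-- The clock configurations are in bijection with PAIRS of Ising configurations. [cite: AizenmanSimon1980RotorIsing, eq. (6)] -/
def suzukiCfgEquiv (V : Type*) : (V → Fin 4) ≃ SpinConfig V × SpinConfig V where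
  toFun k := (fun x => suzukiSigma (k x), fun x => suzukiTau (k x))
  invFun p := fun x => suzukiEquiv.symm (p.1 x, p.2 x)
  left_inv k := funext fun x => suzukiEquiv.symm_apply_apply (k x)
  right_inv p := by
    refine Prod.ext (funext fun x => ?_) (funext fun x => ?_)
    · exact congrArg Prod.fst (suzukiEquiv.apply_symm_apply (p.1 x, p.2 x))
    · exact congrArg Prod.snd (suzukiEquiv.apply_symm_apply (p.1 x, p.2 x))

omit [Fintype V] [DecidableEq V] in
/-- Unfolding of `suzukiCfgEquiv`. [cite: AizenmanSimon1980RotorIsing, eqs. (4)-(6)] -/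
@[simp] theorem suzukiCfgEquiv_apply (k : V → Fin 4) :
    suzukiCfgEquiv V k = (suzukiSigmaCfg k, suzukiTauCfg k) := rfl

omit [Fintype V] [DecidableEq V] in
/-- The rotor two-point observable at a clock configuration is the average of the two Ising bond spins. [cite: AizenmanSimon1980RotorIsing, eq. (6)] -/
theorem cosDiff_quarterCfg (a b : V) (k : V → Fin 4) :
    cosDiff a b (quarterCfg k) = (spinPair a b (suzukiSigmaCfg k) + spinPair a b (suzukiTauCfg k)) / 2 := by
  rw [cosDiff, quarterCfg_apply, quarterCfg_apply, re_conj_quarterTurn_mul_quarterTurn]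
  rfl

omit [DecidableEq V] in
/-- The pair Hamiltonian at a clock configuration splits into the two Ising Hamiltonians. [cite: AizenmanSimon1980RotorIsing, eq. (6)] -/
theorem ginibreHamiltonian_pairChars_quarterCfg (c : V → V → ℝ) (k : V → Fin 4) :
    ginibreHamiltonian (pairChars V) (fun p => 2 * c p.1 p.2) (quarterCfg k) =
      (∑ x, ∑ y, c x y * (spinAt x (suzukiSigmaCfg k) * spinAt y (suzukiSigmaCfg k))) +
        ∑ x, ∑ y, c x y * (spinAt x (suzukiTauCfg k) * spinAt y (suzukiTauCfg k)) := by
  rw [ginibreHamiltonian, Fintype.sum_prod_type, ← Finset.sum_add_distrib]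
  refine Finset.sum_congr rfl fun x _ => ?_
  rw [← Finset.sum_add_distrib]
  refine Finset.sum_congr rfl fun y _ => ?_
  have h : reChar (pairChars V (x, y)) (quarterCfg k) = cosDiff x y (quarterCfg k) := (cosDiff_eq_reChar x y _).symm
  rw [h, cosDiff_quarterCfg]
  simp only [spinPair]
  ring

omit [DecidableEq V] in
/-- **Suzuki factorisation**: the rotor weight at couplings `2c` of a clock configuration is the product of the two Ising weights at
couplings `c`. [cite: AizenmanSimon1980RotorIsing, eq. (6)] -/
theorem ginibreWeight_pairChars_quarterCfg (c : V → V → ℝ) (k : V → Fin 4) :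
    ginibreWeight (pairChars V) (fun p => 2 * c p.1 p.2) (quarterCfg k) =
      PairIsing.weight c (suzukiSigmaCfg k) * PairIsing.weight c (suzukiTauCfg k) := by
  rw [ginibreWeight, ginibreHamiltonian_pairChars_quarterCfg, Real.exp_add]
  rfl

/-- **The `ℤ₄` clock model at `2c` has the Ising two-point function at `c`** (finite sums over the clock configurations).
[cite: AizenmanSimon1980RotorIsing, eq. (6)] -/
theorem clock_twoPoint_eq_ising (c : V → V → ℝ) (a b : V) :
    (∑ k : V → Fin 4, cosDiff a b (quarterCfg k) * ginibreWeight (pairChars V) (fun p => 2 * c p.1 p.2) (quarterCfg k)) /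
        ∑ k : V → Fin 4, ginibreWeight (pairChars V) (fun p => 2 * c p.1 p.2) (quarterCfg k) =
      PairIsing.avg c (spinPair a b) := by
  set w : SpinConfig V → ℝ := PairIsing.weight c with hw
  set Zs : ℝ := ∑ ρ : SpinConfig V, w ρ with hZs
  set Ns : ℝ := ∑ ρ : SpinConfig V, spinPair a b ρ * w ρ with hNs
  have hZpos : 0 < Zs := PairIsing.sum_weight_pos c
  have hden : ∑ k : V → Fin 4, ginibreWeight (pairChars V) (fun p => 2 * c p.1 p.2) (quarterCfg k) = Zs * Zs := by
    simp_rw [ginibreWeight_pairChars_quarterCfg]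
    rw [Fintype.sum_equiv (suzukiCfgEquiv V)
      (fun k => PairIsing.weight c (suzukiSigmaCfg k) * PairIsing.weight c (suzukiTauCfg k))
      (fun q : SpinConfig V × SpinConfig V => w q.1 * w q.2) (fun k => rfl), Fintype.sum_prod_type, Finset.sum_mul_sum]
  have hnum : ∑ k : V → Fin 4, cosDiff a b (quarterCfg k) *
      ginibreWeight (pairChars V) (fun p => 2 * c p.1 p.2) (quarterCfg k) = Ns * Zs := by
    simp_rw [ginibreWeight_pairChars_quarterCfg, cosDiff_quarterCfg]
    rw [Fintype.sum_equiv (suzukiCfgEquiv V)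
      (fun k => (spinPair a b (suzukiSigmaCfg k) + spinPair a b (suzukiTauCfg k)) / 2 *
        (PairIsing.weight c (suzukiSigmaCfg k) * PairIsing.weight c (suzukiTauCfg k)))
      (fun q : SpinConfig V × SpinConfig V => (spinPair a b q.1 + spinPair a b q.2) / 2 * (w q.1 * w q.2))
      (fun k => rfl), Fintype.sum_prod_type]
    have h1 : ∑ x : SpinConfig V, ∑ y : SpinConfig V, (spinPair a b x + spinPair a b y) / 2 * (w x * w y) =
        (∑ x : SpinConfig V, ∑ y : SpinConfig V, (spinPair a b x * w x) * w y) / 2 +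
          (∑ x : SpinConfig V, ∑ y : SpinConfig V, w x * (spinPair a b y * w y)) / 2 := by
      rw [Finset.sum_div, Finset.sum_div, ← Finset.sum_add_distrib]
      refine Finset.sum_congr rfl fun x _ => ?_
      rw [Finset.sum_div, Finset.sum_div, ← Finset.sum_add_distrib]
      refine Finset.sum_congr rfl fun y _ => ?_
      ring
    rw [h1, ← Finset.sum_mul_sum, ← Finset.sum_mul_sum]
    ring
  rw [hnum, hden, PairIsing.avg_def, mul_div_mul_right _ _ hZpos.ne']

end Suzuki

/-! ### §3 The theorem -/

section Main

variable {V : Type*} [Fintype V] [DecidableEq V] [MeasurableSpace Circle] [BorelSpace Circle]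

/-- **The interpolating two-point function converges to the Ising two-point function**: `⟨cos(θ_a − θ_b)⟩_{2c, λ} → ⟨σ_aσ_b⟩_c`
as `λ → ∞` (Laplace limit onto the clock configurations, then Suzuki). [cite: AizenmanSimon1980RotorIsing, eqs. (5)-(6)] -/
theorem tendsto_asTwoPoint (c : V → V → ℝ) (a b : V) :
    Tendsto (fun lam : ℝ => asTwoPoint (fun p : V × V => 2 * c p.1 p.2) lam a b) atTop
      (𝓝 (PairIsing.avg c (spinPair a b))) := by
  set J : V × V → ℝ := fun p => 2 * c p.1 p.2 with hJ
  set w : (V → Circle) → ℝ := ginibreWeight (pairChars V) J with hw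
  have hwc : Continuous w := continuous_ginibreWeight _ _
  have hfwc : Continuous fun θ => cosDiff a b θ * w θ := (continuous_cosDiff a b).mul hwc
  have h1 := tendsto_laplace_quarticField (fun θ => cosDiff a b θ * w θ) hfwc
  have h2 := tendsto_laplace_quarticField w hwc
  have hN : (0 : ℝ) < Fintype.card (V → Fin 4) := by exact_mod_cast Fintype.card_pos
  have hSw : 0 < ∑ k : V → Fin 4, w (quarterCfg k) := Finset.sum_pos (fun k _ => Real.exp_pos _) Finset.univ_nonempty
  have hlim : (∑ k : V → Fin 4, cosDiff a b (quarterCfg k) * w (quarterCfg k)) / Fintype.card (V → Fin 4) /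
      ((∑ k : V → Fin 4, w (quarterCfg k)) / Fintype.card (V → Fin 4)) = PairIsing.avg c (spinPair a b) := by
    rw [div_div_div_cancel_right₀ hN.ne']
    exact clock_twoPoint_eq_ising c a b
  rw [← hlim]
  refine (h1.div h2 (div_pos hSw hN).ne').congr' (Filter.Eventually.of_forall fun lam => ?_)
  simp only [Pi.div_apply]
  have hZ : (∫ θ, Real.exp (lam * quarticField θ) ∂torusHaar V) ≠ 0 :=
    (integral_exp_pos (integrable_torusHaar_of_continuous
      (Real.continuous_exp.comp (continuous_const.mul continuous_quarticField)))).ne'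
  rw [div_div_div_cancel_right₀ hZ, asTwoPoint_eq]

end Main

/-- **Aizenman–Simon 1980, eq. (1) — PROVED.** The plane rotor at couplings `2c` is dominated by the Ising model at couplings `c`:
`⟨cos(θ_a − θ_b)⟩^{rotor}_{2c} ≤ ⟨σ_aσ_b⟩^{Ising}_c` for every finite vertex set, every `c ≥ 0`, all `a, b` (Ginibre monotonicity in the
quartic single-site field `λ cos 4θ`, the `λ → ∞` Laplace limit onto the `ℤ₄` clock model, Suzuki's `ℤ₄ ≅` Ising × Ising).
[cite: AizenmanSimon1980RotorIsing, eq. (1)] -/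
theorem AizenmanSimonRotorIsingComparison_holds : AizenmanSimonRotorIsingComparison := by
  intro ι _ _ _ _ c hc a b
  have hJ : ∀ p : ι × ι, 0 ≤ 2 * c p.1 p.2 := fun p => by have := hc p.1 p.2; positivity
  exact ge_of_tendsto (tendsto_asTwoPoint c a b)
    (Filter.eventually_atTop.2 ⟨0, fun lam hlam => twoPoint_le_asTwoPoint hJ hlam a b⟩)

end PlaneRotator

end Literature.Probability.LatticeModels
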